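import Summits.ValiantsHypothesis.ValiantsHypothesis.Theorems.DefinabilityGapDegreeRoadOne
import HarnessLib

/-!
# DefinabilityGap — Theorem A⁺ in closed form:  `t₀(m) ≥ (m(m−2)/2) · ln( m / ln(64 m⁶) )`

Route `route-ValiantsHypothesis-DefinabilityGap` (decomp-valiant, lens 5: hardness–randomness / PIT axis), supporting
`KIPlantedHitting` (stmt-ValiantsHypothesis-23547) and the degree profile behind `KIAnnihilatorCHDefinable`
(stmt-ValiantsHypothesis-23444). Source: decomp-valiant lens-5 g16, NOTE-g16 §3.6 C3 (asymptotic form of Theorem A⁺).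

MAIN THEOREM `kiPer_hits_of_lt_log`: for `m ≥ 3` and any `t` with
`2t / (m(m−2)) < ln( m / ln(64 m⁶) )`,
NO nonzero polynomial of total degree `≤ t` — of any size — annihilates the generator `G_m = kiPer m`. Equivalently the initial
degree `t₀(m)` of the annihilator ideal of `G_m` satisfies `t₀(m) > t` for every such `t`, i.e.
`t₀(m) ≥ (m(m−2)/2)·ln(m / ln(64 m⁶)) ≈ ½ m² ln(m / (6 ln m))` — a `Θ(log m)` multiple of the number-of-blocks parameter
`q(m) ≍ m²` (`DefinabilityGapDegreeRoadOne/Omega` are the special cases `t = q(m)`, `t = k·q(m)`). Inputs: the refined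
first moment `DefinabilityGapRefinedPatterns.kiPer_hits_of_refined`, `c^{y} ≥ e^{−y/(m−2)}`, `1 − u ≤ e^{−u}`, Bertrand
`q ≤ 2(m²+1) ≤ 4m²`, and `exp ∘ log = id`. Rung 0 of the Valiant ladder; `VP ≠ VNP` untouched. 0 sorry.
-/

set_option linter.dupNamespace false

noncomputable section

open MvPolynomial
open Literature.Computability.AlgebraicComplexity Literature.Computability.MetaComplexity
open Summit.ValiantsHypothesis.ValiantsHypothesis.Theorems.DefinabilityGapAffineRung
open Summit.ValiantsHypothesis.ValiantsHypothesis.Theorems.DefinabilityGapAlienExclusion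
open Summit.ValiantsHypothesis.ValiantsHypothesis.Theorems.DefinabilityGapRandomPatterns
open Summit.ValiantsHypothesis.ValiantsHypothesis.Theorems.DefinabilityGapBlockStep
open Summit.ValiantsHypothesis.ValiantsHypothesis.Theorems.DefinabilityGapRefinedPatterns
open Summit.ValiantsHypothesis.ValiantsHypothesis.Theorems.DefinabilityGapDegreeRoadOne

namespace Summit.ValiantsHypothesis.ValiantsHypothesis.Theorems.DefinabilityGapDegreeRoadLog

variable {m : ℕ}

/-- **Coin bound in exponential form**, `m ≥ 3`: `(1 − c^{N/m})^m ≤ exp(−m · e^{−N/(m(m−2))})`. [this file] -/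
theorem coinBound_le_exp_exp (hm : 3 ≤ m) (N : ℕ) :
    coinBound m N ≤ Real.exp (-((m : ℝ) * Real.exp (-((N : ℝ) / ((m : ℝ) * ((m : ℝ) - 2)))))) := by
  have h3 : (3 : ℝ) ≤ m := by exact_mod_cast hm
  have hm0 : (0 : ℝ) < m := by linarith
  have hy0 : 0 ≤ (N : ℝ) / m := by positivity
  -- `c^y ≥ e^{−y/(m−2)}` with `y = N/m`, and `y/(m−2) = N/(m(m−2))`
  have hcy : Real.exp (-((N : ℝ) / ((m : ℝ) * ((m : ℝ) - 2)))) ≤ cbase m ^ ((N : ℝ) / m) := by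
    have h := exp_neg_le_cbase_rpow hm hy0
    rwa [div_div] at h
  have h0 : 0 ≤ 1 - cbase m ^ ((N : ℝ) / m) :=
    sub_nonneg.2 (Real.rpow_le_one (cbase_nonneg hm) (cbase_le_one hm) hy0)
  have hstep : 1 - cbase m ^ ((N : ℝ) / m) ≤
      Real.exp (-Real.exp (-((N : ℝ) / ((m : ℝ) * ((m : ℝ) - 2))))) := by
    have := Real.add_one_le_exp (-Real.exp (-((N : ℝ) / ((m : ℝ) * ((m : ℝ) - 2)))))
    linarith
  unfold coinBound
  calc (1 - cbase m ^ ((N : ℝ) / m)) ^ m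
        ≤ Real.exp (-Real.exp (-((N : ℝ) / ((m : ℝ) * ((m : ℝ) - 2))))) ^ m := pow_le_pow_left₀ h0 hstep m
    _ = Real.exp (-((m : ℝ) * Real.exp (-((N : ℝ) / ((m : ℝ) * ((m : ℝ) - 2)))))) := by
        rw [← Real.exp_nat_mul]; congr 1; ring

/-- `q(m)³ ≤ 64 m⁶` (Bertrand). [this file] -/
theorem q_cube_le (hm : 1 ≤ m) : (qOf m : ℝ) ^ 3 ≤ 64 * (m : ℝ) ^ 6 := by
  have hq : (qOf m : ℝ) ≤ 2 * ((m : ℝ) * m + 1) := by exact_mod_cast qOf_le m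
  have h1 : (1 : ℝ) ≤ m := by exact_mod_cast hm
  have h4 : (qOf m : ℝ) ≤ 4 * (m : ℝ) ^ 2 := by nlinarith
  calc (qOf m : ℝ) ^ 3 ≤ (4 * (m : ℝ) ^ 2) ^ 3 := pow_le_pow_left₀ (Nat.cast_nonneg _) h4 3
    _ = 64 * (m : ℝ) ^ 6 := by ring

/-- **The refined first-moment condition in closed form**, `m ≥ 3`: if `2t/(m(m−2)) < ln(m / ln(64 m⁶))` then
`q(m)³ · (1 − c^{2t/m})^m < 1`. [this file] -/
theorem q_cube_mul_coinBound_lt_one_of_lt_log (hm : 3 ≤ m) {t : ℕ}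
    (hx : (2 * t : ℝ) / ((m : ℝ) * ((m : ℝ) - 2)) < Real.log ((m : ℝ) / Real.log (64 * (m : ℝ) ^ 6))) :
    (qOf m : ℝ) ^ 3 * coinBound m (2 * t) < 1 := by
  have h3 : (3 : ℝ) ≤ m := by exact_mod_cast hm
  have hm0 : (0 : ℝ) < m := by linarith
  set x : ℝ := (2 * t : ℝ) / ((m : ℝ) * ((m : ℝ) - 2)) with hxdef
  set L : ℝ := Real.log (64 * (m : ℝ) ^ 6) with hL
  have hbig : (1 : ℝ) < 64 * (m : ℝ) ^ 6 := by nlinarith [pow_le_pow_left₀ (by norm_num : (0:ℝ) ≤ 3) h3 6]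
  have hL0 : 0 < L := Real.log_pos hbig
  -- `e^x < m / L`, hence `L < m e^{−x}` and `64 m⁶ = e^L < exp(m e^{−x})`
  have hex : Real.exp x < (m : ℝ) / L := by
    have h := Real.exp_lt_exp.2 hx
    rwa [Real.exp_log (div_pos hm0 hL0)] at h
  have hL1 : L < (m : ℝ) * Real.exp (-x) := by
    have h1 : Real.exp x * L < m := by rwa [← lt_div_iff₀ hL0]
    have h2 : L = (Real.exp x * L) * Real.exp (-x) := by
      rw [mul_comm (Real.exp x) L, mul_assoc, ← Real.exp_add, add_neg_cancel, Real.exp_zero, mul_one]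
    rw [h2]
    exact mul_lt_mul_of_pos_right h1 (Real.exp_pos _)
  have h64 : (64 : ℝ) * (m : ℝ) ^ 6 < Real.exp ((m : ℝ) * Real.exp (-x)) := by
    calc (64 : ℝ) * (m : ℝ) ^ 6 = Real.exp L := (Real.exp_log (by linarith)).symm
      _ < Real.exp ((m : ℝ) * Real.exp (-x)) := Real.exp_lt_exp.2 hL1
  -- the coin bound
  have hCB : coinBound m (2 * t) ≤ Real.exp (-((m : ℝ) * Real.exp (-x))) := by
    have h := coinBound_le_exp_exp hm (2 * t)
    have hcast : (((2 * t : ℕ) : ℝ) / ((m : ℝ) * ((m : ℝ) - 2))) = x := by rw [hxdef]; push_cast; ring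
    rwa [hcast] at h
  have hCB0 : 0 ≤ coinBound m (2 * t) := by
    unfold coinBound
    exact pow_nonneg (sub_nonneg.2 (Real.rpow_le_one (cbase_nonneg hm) (cbase_le_one hm) (by positivity))) _
  calc (qOf m : ℝ) ^ 3 * coinBound m (2 * t) ≤ 64 * (m : ℝ) ^ 6 * coinBound m (2 * t) :=
        mul_le_mul_of_nonneg_right (q_cube_le (by omega)) hCB0
    _ ≤ 64 * (m : ℝ) ^ 6 * Real.exp (-((m : ℝ) * Real.exp (-x))) := mul_le_mul_of_nonneg_left hCB (by positivity)
    _ < Real.exp ((m : ℝ) * Real.exp (-x)) * Real.exp (-((m : ℝ) * Real.exp (-x))) :=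
        mul_lt_mul_of_pos_right h64 (Real.exp_pos _)
    _ = 1 := by rw [← Real.exp_add, add_neg_cancel, Real.exp_zero]

/-- **Theorem A⁺, closed form.** For `m ≥ 3` and `2t/(m(m−2)) < ln(m / ln(64 m⁶))`: every nonzero `D` of total degree
`≤ t`, of any size, satisfies `D ∘ G_m ≠ 0`. So `t₀(m) ≥ (m(m−2)/2)·ln(m / ln(64 m⁶))`. [this file] -/
theorem kiPer_hits_of_lt_log (hm : 3 ≤ m) {t : ℕ}
    (hx : (2 * t : ℝ) / ((m : ℝ) * ((m : ℝ) - 2)) < Real.log ((m : ℝ) / Real.log (64 * (m : ℝ) ^ 6)))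
    (D : MvPolynomial (Fin 3 → Fin (qOf m)) ℂ) (hD : D ≠ 0) (hdeg : D.totalDegree ≤ t) :
    MvPolynomial.bind₁ (kiPer m) D ≠ 0 :=
  kiPer_hits_of_refined hm (q_cube_mul_coinBound_lt_one_of_lt_log hm hx) D hD hdeg

/-- Pointwise form: an annihilator `D ≠ 0` of `G_m` (`m ≥ 3`) has `2·deg D/(m(m−2)) ≥ ln(m / ln(64 m⁶))`. [this file] -/
theorem log_le_of_annihilator (hm : 3 ≤ m) {D : MvPolynomial (Fin 3 → Fin (qOf m)) ℂ} (hD : D ≠ 0)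
    (hann : MvPolynomial.bind₁ (kiPer m) D = 0) :
    Real.log ((m : ℝ) / Real.log (64 * (m : ℝ) ^ 6)) ≤ (2 * D.totalDegree : ℝ) / ((m : ℝ) * ((m : ℝ) - 2)) := by
  by_contra h
  exact kiPer_hits_of_lt_log hm (not_le.1 h) D hD le_rfl hann

/-- Width form: every monomial `κ₀` of an annihilator of `G_m` (`m ≥ 3`) involves `s` variables with
`2s/(m(m−2)) ≥ ln(m / ln(64 m⁶))`. [this file] -/
theorem log_le_of_annihilator_support (hm : 3 ≤ m) {D : MvPolynomial (Fin 3 → Fin (qOf m)) ℂ}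
    (hann : MvPolynomial.bind₁ (kiPer m) D = 0) {κ₀ : (Fin 3 → Fin (qOf m)) →₀ ℕ} (hκ₀ : κ₀ ∈ D.support) :
    Real.log ((m : ℝ) / Real.log (64 * (m : ℝ) ^ 6)) ≤ (2 * κ₀.support.card : ℝ) / ((m : ℝ) * ((m : ℝ) - 2)) := by
  by_contra h
  have hcount := q_cube_mul_coinBound_lt_one_of_lt_log hm (t := κ₀.support.card) (not_le.1 h)
  obtain ⟨π, hπ⟩ := exists_starFree_refined hm κ₀ hcount
  exact kiPer_hits_of_starFree D hκ₀ hπ hann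

end Summit.ValiantsHypothesis.ValiantsHypothesis.Theorems.DefinabilityGapDegreeRoadLog
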